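import Summits.CriticalPhenomena.CardyFormulaZ2.Theses.CardyMaterialLaw

/-!
# Birth skeleton — crux `LimitRegularity` of route `CardyMaterialLaw` (item stmt-CriticalPhenomena-11172)

Line `birth` (the harmonic / mean-value line). The crux asks that every locally uniform
subsequential limit `G = (G₀, G₁, G₂)` of the bond-`ℤ²` separating triple
`bondSeparatingProb T α (u n)` on a 3-marked Jordan domain `T` be real-differentiable on the open
carrier `T.carrier`. Pointwise differentiability has no discrete counterpart that survives locally
uniform limits; INTEGRATED identities do. The line therefore routes the crux through the one
regularity mechanism known to pass to the limit — the mean-value (harmonicity) property — cut into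
three named lemmas of three different tiers:

* `stub_separatingLimit_continuousOn` (RSW tier, provable in kind now): limits are continuous on the carrier
  (three-arm/RSW equicontinuity above the mesh scale, Bollobás–Riordan 2006 Ch. 7 Claim 22 p. 197,
  Smirnov arXiv:0909.4499 Lemma 2.2, transplanted to bond-`ℤ²`).
* `stub_limit_circleMeanValue` (the load-bearing, CI-strength stub): every limit `G_α` has the
  mean-value property over the closed discs inside the carrier,
  `G α z = Real.circleAverage (G α) z r`. True in the Cardy world (limits are
  `1/3 + (2/3) Re(ψ s^{-α})`, harmonic); strictly WEAKER than the contour identity (36) of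
  Bollobás–Riordan / `CardyHarmonicInvariants.MoreraOnZ2` (no phase relation between the three
  components is asserted) and strictly STRONGER than the crux.
* `stub_meanValue_harmonicOnNhd` (classical analysis, provable now from the tree): a function
  continuous on an open `U ⊆ ℂ` with the circle mean-value property over the closed discs in `U`
  is harmonic on `U` (converse mean-value theorem; Ransford 1995 Thm. 1.2.? / Axler–Bourdon–Ramey
  Thm. 1.24). Tree inputs: `Literature.Analysis.Complex.exists_harmonicContOnCl_eqOn_sphere`
  (disc Dirichlet problem, `DiscDirichletProblem.lean`), Mathlib
  `HarmonicContOnCl.circleAverage_eq`, and the strong maximum principle for the circle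
  sub-mean-value property `eqOn_of_isMaxOn_of_le_circleAverage_of_subset`
  (`SubMeanValueLocalMaximumPrinciple.lean`) applied to `±(f − h)` on the disc.

`LimitRegularity_of` composes them (harmonic ⇒ `C²` ⇒ differentiable on the open carrier) and
concludes the route decl `Summit.CriticalPhenomena.CardyFormulaZ2.Theses.CardyMaterialLaw.LimitRegularity`
by name. Shape (D-0027 §3.3, as in `Cruxes/IsingJetsConformal/Lines/birth.lean` and
`Cruxes/MeckeRigidity/Lines/birth.lean`): the registered stubs are the theorems
`stub_<name> : <statement over tree declarations> := by sorry` (the ONLY sorries of the file); the by-name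
`Prop` handles `Stubs.stub_<name> := type_of% stub_<name>` are what the layer-invariant audit
`#h21_check_skeleton` requires of the hypotheses of `LimitRegularity_of` (the `@[stub]` tag is
gate-stamped, not written by a seat); the final `example` checks that
`LimitRegularity_of stub₁ stub₂ stub₃ : LimitRegularity` typechecks (the two spellings agree
definitionally).
-/

namespace Summit.CriticalPhenomena.CardyFormulaZ2.Cruxes.LimitRegularity.Birth

/-- **Stub 1 (RSW tier).** Every locally uniform subsequential limit of the bond-`ℤ²` separating
triple on a 3-marked Jordan domain is continuous on the (open) carrier. Mechanism: for
`|z − z'| = r ≫ δ`, `|H^δ_α(z) − H^δ_α(z')| ≤ P[three arms (open, open, dual) from B(z, r) to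
distance dist(z, ∂Ω)] ≤ C (r / dist(z, ∂Ω))^ε` uniformly in `δ ≤ r` (RSW), so limits are locally
Hölder. [Bollobás–Riordan 2006, Ch. 7 Claim 22; Smirnov arXiv:0909.4499 Lemma 2.2] -/
theorem stub_separatingLimit_continuousOn :
    ∀ (T : Literature.Probability.RandomPlanarGeometry.MarkedDomain 3) (u : ℕ → ℝ)
      (G : Fin 3 → ℂ → ℝ), (∀ n, 0 < u n) → Filter.Tendsto u Filter.atTop (nhds 0) →
      (∀ α : Fin 3, TendstoLocallyUniformlyOn
        (fun (n : ℕ) (z : ℂ) => Literature.Probability.Percolation.bondSeparatingProb T α (u n) z)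
        (G α) Filter.atTop T.carrier) →
      ∀ α : Fin 3, ContinuousOn (G α) T.carrier := by
  sorry

/-- **Stub 2 (load-bearing, CI-strength).** Every locally uniform subsequential limit `G_α` of the
bond-`ℤ²` separating triple has the circle mean-value property over every closed disc contained in
the carrier: `G α z = circleAverage (G α) z r`. In the Cardy world `G_α = 1/3 + (2/3) Re(ψ s^{-α})`
is harmonic, so this holds; no weaker input than conformal invariance is known to give it — this is
where the open problem sits on this line. Strictly weaker than the Bollobás–Riordan contour
identity (36) (no phase relation between components), strictly stronger than the crux.
[Bollobás–Riordan 2006, Ch. 7 (36)–(38); Smirnov 2001 Thm. 1; Grimmett 2018 §5.7] -/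
theorem stub_limit_circleMeanValue :
    ∀ (T : Literature.Probability.RandomPlanarGeometry.MarkedDomain 3) (u : ℕ → ℝ)
      (G : Fin 3 → ℂ → ℝ), (∀ n, 0 < u n) → Filter.Tendsto u Filter.atTop (nhds 0) →
      (∀ α : Fin 3, TendstoLocallyUniformlyOn
        (fun (n : ℕ) (z : ℂ) => Literature.Probability.Percolation.bondSeparatingProb T α (u n) z)
        (G α) Filter.atTop T.carrier) →
      ∀ α : Fin 3, ∀ z ∈ T.carrier, ∀ r : ℝ, 0 < r → Metric.closedBall z r ⊆ T.carrier →
        G α z = Real.circleAverage (G α) z r := by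
  sorry

/-- **Stub 3 (converse mean-value theorem; classical, provable now).** A real function continuous
on an open set `U ⊆ ℂ` with the circle mean-value property over every closed disc contained in
`U` is harmonic on `U`. Proof plan in the tree: on a disc `closedBall c R ⊆ U` solve the Dirichlet
problem with boundary data `f` (`Literature.Analysis.Complex.exists_harmonicContOnCl_eqOn_sphere`);
the solution `h` has the mean-value property (`HarmonicContOnCl.circleAverage_eq`), so `f − h` and
`h − f` are continuous on the closed disc, vanish on the sphere and satisfy the circle
sub-mean-value property on the open disc; the strong maximum principle
(`eqOn_of_isMaxOn_of_le_circleAverage_of_subset`) forces `f = h` on the disc, so `f` is harmonic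
at `c`. [Ransford 1995, Thm. 1.2.?; Axler–Bourdon–Ramey, Harmonic Function Theory, Thm. 1.24] -/
theorem stub_meanValue_harmonicOnNhd :
    ∀ (U : Set ℂ) (f : ℂ → ℝ), IsOpen U → ContinuousOn f U →
      (∀ z ∈ U, ∀ r : ℝ, 0 < r → Metric.closedBall z r ⊆ U → f z = Real.circleAverage f z r) →
      InnerProductSpace.HarmonicOnNhd f U := by
  sorry

/-! ### By-name `Prop` handles of the three registered stubs (D-0027 §3.3) -/

namespace Stubs

/-- By-name handle: the statement of the registered stub `stub_separatingLimit_continuousOn`. -/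
def stub_separatingLimit_continuousOn : Prop :=
  type_of% _root_.Summit.CriticalPhenomena.CardyFormulaZ2.Cruxes.LimitRegularity.Birth.stub_separatingLimit_continuousOn

/-- By-name handle: the statement of the registered stub `stub_limit_circleMeanValue`. -/
def stub_limit_circleMeanValue : Prop :=
  type_of% _root_.Summit.CriticalPhenomena.CardyFormulaZ2.Cruxes.LimitRegularity.Birth.stub_limit_circleMeanValue

/-- By-name handle: the statement of the registered stub `stub_meanValue_harmonicOnNhd`. -/
def stub_meanValue_harmonicOnNhd : Prop :=
  type_of% _root_.Summit.CriticalPhenomena.CardyFormulaZ2.Cruxes.LimitRegularity.Birth.stub_meanValue_harmonicOnNhd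

end Stubs

/-! ### The composition (sorry-free): the three stubs imply the crux BY NAME -/

/-- **Composition (kernel-checked, no sorry).** Hypotheses = the three stub statements BY NAME
(`Stubs.stub_*`), conclusion = the route decl `CardyMaterialLaw.LimitRegularity` BY NAME: a limit is
continuous (stub 1) and has the circle mean-value property (stub 2) on the open carrier, hence is
harmonic there (stub 3), hence `C²`, hence real-differentiable on the carrier. [folklore] -/
theorem LimitRegularity_of (hcont : Stubs.stub_separatingLimit_continuousOn)
    (hmv : Stubs.stub_limit_circleMeanValue) (hharm : Stubs.stub_meanValue_harmonicOnNhd) :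
    Summit.CriticalPhenomena.CardyFormulaZ2.Theses.CardyMaterialLaw.LimitRegularity := by
  unfold Stubs.stub_separatingLimit_continuousOn at hcont
  unfold Stubs.stub_limit_circleMeanValue at hmv
  unfold Stubs.stub_meanValue_harmonicOnNhd at hharm
  intro T u G hu hu0 hlim α
  -- the carrier of a Jordan domain is open
  have hU : IsOpen T.carrier := T.isOpen
  -- stub 1: the limit component `G α` is continuous on the carrier
  have hc : ContinuousOn (G α) T.carrier := hcont T u G hu hu0 hlim α
  -- stub 2: it has the circle mean-value property over the closed discs inside the carrier
  have hm : ∀ z ∈ T.carrier, ∀ r : ℝ, 0 < r → Metric.closedBall z r ⊆ T.carrier →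
      G α z = Real.circleAverage (G α) z r := hmv T u G hu hu0 hlim α
  -- stub 3: hence it is harmonic on the carrier
  have hh : InnerProductSpace.HarmonicOnNhd (G α) T.carrier := hharm T.carrier (G α) hU hc hm
  -- harmonic ⇒ C² ⇒ differentiable at every point of the open carrier
  intro z hz
  have h2 : ContDiffAt ℝ 2 (G α) z := (hh z hz).1
  exact (h2.differentiableAt (by norm_num)).differentiableWithinAt

/-- Agreement check: the registered (sorried) stubs feed the composition literally, so the two
spellings of each stub statement agree definitionally and the skeleton proves the crux modulo
exactly the three stubs. -/
example : Summit.CriticalPhenomena.CardyFormulaZ2.Theses.CardyMaterialLaw.LimitRegularity :=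
  LimitRegularity_of stub_separatingLimit_continuousOn stub_limit_circleMeanValue stub_meanValue_harmonicOnNhd

end Summit.CriticalPhenomena.CardyFormulaZ2.Cruxes.LimitRegularity.Birth
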